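import Summits.BirchSwinnertonDyer.BirchSwinnertonDyer.Theorems.GenusKolyvaginAtTwoGenusDeepSupplyAtTwoNegDiscNarrowDepthZeroInertia
import Summits.BirchSwinnertonDyer.BirchSwinnertonDyer.Theorems.GenusKolyvaginAtTwoGenusDeepSupplyAtTwoNegDiscNarrowDepthZeroCriterion
import Summits.BirchSwinnertonDyer.BirchSwinnertonDyer.Theorems.GenusKolyvaginAtTwoGenusDeepSupplyAtTwoNegDiscNarrowOfKernels
import Summits.BirchSwinnertonDyer.BirchSwinnertonDyer.Theorems.GenusKolyvaginAtTwoKolyvaginRelationAtTwoLemma43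
import Literature.NumberTheory.EllipticCurves.HeegnerPointReflectionHolds
import Literature.NumberTheory.EllipticCurves.HeegnerPointsOfConductorOneGaloisConjProofs
import Literature.NumberTheory.EllipticCurves.BSDSelmerPConverseYanZhuKolyvaginSystemProofs
import Literature.NumberTheory.EllipticCurves.McCallum1991.DivisibilityDescent
import Literature.NumberTheory.EllipticCurves.BSDRootNumberOddParityProofs
import HarnessLib

/-!
# Route `GenusKolyvaginAtTwo`, crux 23491 `GenusDeepSupplyAtTwoNegDiscNarrow` (and its Δ>0 twin 25504), registered stub C‴:
# THE DEPTH-ZERO REDUCTION CRITERION, INSTANTIATED (II) — assembly for the Heegner point, in the cruxes' currency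

Seat `bsd-line-gk2-p5` g33 (cell `bsd-f1-sign2`, WIDTH-5 attach), `--supports stmt-BirchSwinnertonDyer-23491 --as helper`.
THEOREMS ONLY (no definition, no named fact, no `sorry`).  **BSD is NOT proved by this file and no item is closed by it; the registered
stub C‴ is untouched.**

WHAT.  The LEAD's kernel `GenusSupplyNarrow.geomReduction_eq_of_two_smul_of_inertia_anti` (p761607) run on: the inertia element
`γ ∈ I_𝔓(Γ_ℚ)` at a good prime `ℓ ∣ d_K` acting as `τ` on `K` and the equivariant embedding `e_* : E(K) ↪ E(ℚ̄)` (sibling file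
`…DepthZeroInertia`), `A := e_*(E(K))` (NOT `E(K[1])`: McCallum's Lemma 5.1 `exists_pow_smul_eq_derivedPoint_one_iff` moves
`2`-power divisibility of `y_K = P(1)` between `E(K[1])` and `E(K)`), `Y = e_* P`, `t = e_*(τP + P)`:

* §3 **the criterion for a Heegner point `P ∈ E(K)`** with `w(E) = +1` (Gross Prop. 5.3 ∕ Darmon Prop. 3.11, tree
  `heegnerPoint_conj_add_rootNumber_smul_holds`: `τP + P ∈ E(K)_tors`) and `E(K)[2] = 0`, at a good prime `ℓ ∣ d_K`:
  **`2^M ∣ P` in `E(K)` with `M ≥ 1` ⟹ `red_ℓ(e_* P) = red_ℓ(e_* s)` for a torsion point `s ∈ E(K)` fixed by `Aut(K/ℚ)`**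
  (`geomReduction_heegnerPoint_eq_of_two_pow_smul`), `red_ℓ = geomReduction` at the tree's place of `ℚ̄` over `ℓ`;
* §4 **in the cruxes' currency** (`r_an(E) = 0` so `w(E) = +1` by `rootNumber_eq_one_of_even_analyticRank`; `ρ̄_{E,2}` onto and
  `d_K Δ_E ∉ ℚ²` so `E(K[1])[2] = 0` by `GenusExact.torsionBy_two_ringClassField_eq_bot`; `P₀ ↦ P(1) = d₁.derivedPoint`):
  **if `red_ℓ(e_* P₀)` is not the reduction of an `Aut(K/ℚ)`-fixed torsion point of `E(K)`, then `M₀ = 0`**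
  (`depth_eq_zero_of_geomReduction_ne`), hence the cruxes' deep clause holds with `n = 1`
  (`exists_deepWitness_of_geomReduction_ne`, through the LEAD's `exists_deepWitness_of_depth_zero`).
Sign-free throughout (no hypothesis on `Δ_E`), so it serves 25504's C⁺‴ verbatim.  What this does NOT do: decide the bit
«`red_ℓ(y_K) ∉ red(E(K)_tors^{Gal})`» on any cell (memo §2 Claim B / §3: a ramified Jochnowitz congruence, beyond print).

References: [GrossLMS1991] §5 Prop. 5.3, §4 (4.1), Lemma 4.3; [McCallumLMS1991] §5 Lemma 5.1; [Darmon2004] Prop. 3.11;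
[Serre1972] §1.11 Prop. 11; [SilvermanAEC2009] VII.2.1, VIII.§1.
-/

set_option autoImplicit false
set_option linter.dupNamespace false -- `Summit.<P>.<Sub>` repeats `BirchSwinnertonDyer` (D-0017)

noncomputable section

open scoped Classical NumberField Pointwise

namespace Summit.BirchSwinnertonDyer.BirchSwinnertonDyer.Theorems.GenusSupplyNarrow.DepthZero

open IsDedekindDomain Field NumberField WeierstrassCurve Literature.NumberTheory.EllipticCurves
  Literature.NumberTheory.EllipticCurves.ModularForms Literature.NumberTheory.GaloisRepresentations Rat.HeightOneSpectrum
  Summit.BirchSwinnertonDyer.BirchSwinnertonDyer.Theorems.GenusSupplyNarrow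

variable {K : Type} [Field K] [NumberField K]

/-! ## §3 The criterion for a Heegner point in `E(K)`-currency -/

/-- **THE DEPTH-ZERO REDUCTION CRITERION, `E(K)`-CURRENCY (sign-free).**  `W/ℚ` globally minimal of conductor `N`, `K` imaginary
quadratic with the Heegner hypothesis, `P ∈ E(K)` a Heegner point of level `N`, `w(E) = +1`, `E(K)[2] = 0`, `ℓ ∣ d_K` a prime of good
reduction.  If `2^M ∣ P` in `E(K)` with `M ≥ 1`, then **`red_ℓ(e_* P) = red_ℓ(e_* s)` for some torsion point `s ∈ E(K)` fixed by
`Aut(K/ℚ)`**, `red_ℓ = geomReduction` at the tree's place of `ℚ̄` over `ℓ`, `e_* = Affine.Point.map (absEmbedding ℚ K)`.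
Proof = the LEAD's kernel `geomReduction_eq_of_two_smul_of_inertia_anti` at `A = e_*(E(K))`, `Y = e_* P`, `t = e_*(τP + P)` (torsion by
Darmon Prop. 3.11 ∕ Gross Prop. 5.3 with `w = +1`, tree `heegnerPoint_conj_add_rootNumber_smul_holds`; `γ`-fixed as `τ² = 1`; odd order
as `A[2] = 0`), `γ` the inertia element of §1.  [cite: GrossLMS1991, §5 Prop. 5.3, §4 (4.1)] [cite: Darmon2004, Prop. 3.11]
[cite: Serre1972, §1.11, Prop. 11 (proof)] -/
theorem geomReduction_heegnerPoint_eq_of_two_pow_smul (W : WeierstrassCurve ℚ) [W.IsElliptic] [W.IsGloballyMinimal]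
    [NeZero (W.conductorNorm ℤ)] (hK : IsImaginaryQuadratic K) (hH : SatisfiesHeegnerHypothesis (W.conductorNorm ℤ) K)
    {P : (W.baseChange K).toAffine.Point} (hP : IsHeegnerPoint (W.conductorNorm ℤ) W K P) (hw1 : W.rootNumber = 1)
    (h2K : ∀ T : (W.baseChange K).toAffine.Point, (2 : ℤ) • T = 0 → T = 0)
    {ℓ : ℕ} [Fact ℓ.Prime] (hℓ : (ℓ : ℤ) ∣ NumberField.discr K) (hΔ : ¬ (ℓ : ℤ) ∣ minimalDiscriminantInt W)
    {M : ℕ} (hM : 1 ≤ M) (hdiv : ∃ Q : (W.baseChange K).toAffine.Point, ((2 ^ M : ℕ) : ℤ) • Q = P) :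
    ∃ s : (W.baseChange K).toAffine.Point, IsOfFinAddOrder s ∧ (∀ σ : K ≃ₐ[ℚ] K, σ • s = s) ∧
      geomReduction hΔ (Affine.Point.map (W' := W) (absEmbedding ℚ K) P : W.geomPoints) =
        geomReduction hΔ (Affine.Point.map (W' := W) (absEmbedding ℚ K) s : W.geomPoints) := by
  have h2 : Module.finrank ℚ K = 2 := hK.1
  haveI : Algebra.IsQuadraticExtension ℚ K := ⟨h2⟩
  haveI : IsGalois ℚ K := inferInstance
  have hcard : Nat.card (K ≃ₐ[ℚ] K) = 2 := by rw [IsGalois.card_aut_eq_finrank, h2]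
  -- the place `v = ℓ`, the prime `𝔓` of the place of `ℚ̄` over `ℓ`, the inertia element
  obtain ⟨v, hv⟩ : ∃ v : HeightOneSpectrum (𝓞 ℚ), (primesEquiv v : ℕ) = ℓ :=
    ⟨primesEquiv.symm ⟨ℓ, Fact.out⟩, by rw [Equiv.apply_symm_apply]⟩
  obtain ⟨𝔓, hmem, h𝔓⟩ := exists_ideal_placeOver (p := ℓ) hv
  obtain ⟨γ, hγI, τ, hτ1, hγ⟩ := exists_mem_inertia_smul_absEmbedding_eq h2 hℓ hv h𝔓
  have hττ : τ * τ = 1 := by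
    rcases Literature.NumberTheory.QuadraticFields.eq_one_or_eq_of_card_eq_two hcard hτ1 (τ * τ) with h | h
    · exact h
    · exact absurd (mul_left_cancel (a := τ) (h.trans (mul_one τ).symm)) hτ1
  -- the embedding `e_*` and its image `A`
  obtain ⟨e, he⟩ : ∃ e : (W.baseChange K).toAffine.Point →+ W.geomPoints,
      e = Affine.Point.map (W' := W) (absEmbedding ℚ K) := ⟨_, rfl⟩
  have heinj : Function.Injective e := by rw [he]; exact Affine.Point.map_injective (W' := W) _
  have hequiv : ∀ R : (W.baseChange K).toAffine.Point, γ • e R = e (τ • R) := fun R ↦ by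
    rw [he]; exact smul_eq_map_absEmbedding_smul W hγ R _ rfl
  set A : AddSubgroup W.geomPoints := e.range with hA
  have hAst : ∀ R ∈ A, γ • R ∈ A := by
    rintro _ ⟨R, rfl⟩
    exact ⟨τ • R, (hequiv R).symm⟩
  have hA2 : ∀ R ∈ A, (2 : ℤ) • R = 0 → R = 0 := by
    rintro _ ⟨R, rfl⟩ h
    have h' : e ((2 : ℤ) • R) = e 0 := by rw [map_zsmul, h, map_zero]
    rw [h2K R (heinj h'), map_zero]
  -- Gross 5.3 / Darmon 3.11: `t₀ := τP + P` is torsion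
  have hσ : (τ : K →ₐ[ℚ] K) ≠ AlgHom.id ℚ K := fun h ↦ hτ1 (AlgEquiv.ext fun x ↦ DFunLike.congr_fun h x)
  set t₀ : (W.baseChange K).toAffine.Point := τ • P + P with ht₀
  have ht₀fin : IsOfFinAddOrder t₀ := by
    have h := heegnerPoint_conj_add_rootNumber_smul.apply heegnerPoint_conj_add_rootNumber_smul_holds hK hH hP hσ
    rwa [hw1, one_smul, ← WeierstrassCurve.smul_def W K τ P] at h
  have hτP : τ • P = -P + t₀ := by rw [ht₀]; abel
  have hτt₀ : τ • t₀ = t₀ := by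
    rw [ht₀, smul_add, ← mul_smul, hττ, one_smul, add_comm]
  -- the kernel's hypotheses
  have hY : γ • e P = -e P + e t₀ := by rw [hequiv, hτP, map_add, map_neg]
  have ht : γ • e t₀ = e t₀ := by rw [hequiv, hτt₀]
  have hodd : Odd (addOrderOf (e t₀)) := by
    refine odd_addOrderOf_of_two_torsionFree (e.isOfFinAddOrder ht₀fin) fun k hk ↦ ?_
    exact hA2 _ (A.nsmul_mem ⟨t₀, rfl⟩ k) hk
  obtain ⟨Q₀, hQ₀⟩ := hdiv
  obtain ⟨M', rfl⟩ := Nat.exists_eq_add_of_le' hM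
  have h2pow : (2 : ℤ) * ((2 ^ M' : ℕ) : ℤ) = ((2 ^ (M' + 1) : ℕ) : ℤ) := by push_cast; ring
  have hQ : (2 : ℤ) • e (((2 ^ M' : ℕ) : ℤ) • Q₀) = e P := by
    rw [← map_zsmul, smul_smul, h2pow, hQ₀]
  have hkey := geomReduction_eq_of_two_smul_of_inertia_anti (p := ℓ) hΔ hmem hγI A hAst hA2 ⟨t₀, rfl⟩ hY ht hodd
    ⟨_, rfl⟩ hQ
  -- the torsion point `s := (half) • t₀`
  set c : ℤ := (((addOrderOf (e t₀) + 1) / 2 : ℕ) : ℤ) with hc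
  have hsm : τ • (c • t₀) = c • (τ • t₀) := map_zsmul (DistribSMul.toAddMonoidHom _ τ) c t₀
  refine ⟨c • t₀, ht₀fin.zsmul, fun σ ↦ ?_, ?_⟩
  · rcases Literature.NumberTheory.QuadraticFields.eq_one_or_eq_of_card_eq_two hcard hτ1 σ with rfl | rfl
    · exact one_smul _ _
    · rw [hsm, hτt₀]
  · have hfin : geomReduction hΔ (e P) = geomReduction hΔ (e (c • t₀)) :=
      hkey.trans (congrArg (geomReduction hΔ) (map_zsmul e c t₀).symm)
    rw [he] at hfin
    exact hfin

/-! ## §4 In the supply cruxes' currency: `M₀ = 0`, and the deep clause with `n = 1` -/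

/-- **`M₀ = 0` FROM ONE REDUCTION** (the cruxes' currency).  Habitat-type hypotheses: `r_an(E) = 0` (so `w(E) = +1`), `ρ̄_{E,2}` onto and
`d_K·Δ_E ∉ ℚ²` (so `E(K[1])[2] = 0`, Gross Lemma 4.3 at `2`), `K` a Heegner field, `d₁` a conductor-`1` Kolyvagin–Heegner datum with
`P(1) = y_K` the image of `P₀ ∈ E(K)`, `ℓ ∣ d_K` a good prime.  **If `red_ℓ(e_* P₀)` differs from `red_ℓ(e_* s)` for every
`Aut(K/ℚ)`-fixed torsion point `s ∈ E(K)` (for `E(ℚ)_tors = 0`: if `y_K ≢ Õ` at the place over `ℓ`), then `y_K ∉ 2^{M₀}E(K[1])` for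
every `M₀ ≥ 1`, i.e. McCallum's exponent is `M₀ = 0`.**  (§3 + McCallum Lemma 5.1 `exists_pow_smul_eq_derivedPoint_one_iff`.)
[cite: GrossLMS1991, §5 Prop. 5.3, §4 (4.1) and Lemma 4.3] [cite: McCallumLMS1991, §5 Lemma 5.1] -/
theorem depth_eq_zero_of_geomReduction_ne (W : WeierstrassCurve ℚ) [W.IsElliptic] [W.IsGloballyMinimal]
    [NeZero (W.conductorNorm ℤ)] (hK : IsImaginaryQuadratic K) (hH : SatisfiesHeegnerHypothesis (W.conductorNorm ℤ) K)
    (hr0 : W.analyticRank = 0) (hρ : W.HasSurjectiveModNGaloisRep 2) (hsq : ¬ IsSquare ((NumberField.discr K : ℚ) * W.Δ))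
    {ℓ : ℕ} [Fact ℓ.Prime] (hℓ : (ℓ : ℤ) ∣ NumberField.discr K) (hΔ : ¬ (ℓ : ℤ) ∣ minimalDiscriminantInt W)
    (Dt : ModularParametrizationData W (W.conductorNorm ℤ)) (β : ℤ) (ι : K →+* ℂ) (d₁ : KolyvaginHeegnerData Dt β ι 1)
    {P₀ : (W.baseChange K).toAffine.Point}
    (hP₀ : Affine.Point.map (W' := W) (algebraMap K (ringClassField K ι 1)).toRatAlgHom P₀ = d₁.derivedPoint)
    (hred : ∀ s : (W.baseChange K).toAffine.Point, IsOfFinAddOrder s → (∀ σ : K ≃ₐ[ℚ] K, σ • s = s) →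
      geomReduction hΔ (Affine.Point.map (W' := W) (absEmbedding ℚ K) P₀ : W.geomPoints) ≠
        geomReduction hΔ (Affine.Point.map (W' := W) (absEmbedding ℚ K) s : W.geomPoints))
    {M₀ : ℕ} (hdiv : ∃ Q : (W.baseChange (ringClassField K ι 1)).toAffine.Point, ((2 ^ M₀ : ℕ) : ℤ) • Q = d₁.derivedPoint) :
    M₀ = 0 := by
  by_contra hM0
  have hM : 1 ≤ M₀ := Nat.one_le_iff_ne_zero.mpr hM0
  -- `E(K[1])[2] = 0`, hence `E(K)[2] = 0`
  have htors : ∀ T : (W.baseChange (ringClassField K ι 1)).toAffine.Point, (2 : ℤ) • T = 0 → T = 0 := by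
    intro T hT
    have h := GenusExact.torsionBy_two_ringClassField_eq_bot W hK ι one_ne_zero hρ hsq
    have hT' : T ∈ AddSubgroup.torsionBy (W.baseChange (ringClassField K ι 1)).toAffine.Point ((2 : ℕ) : ℤ) :=
      (Submodule.mem_torsionBy_iff _ T).mpr (by exact_mod_cast hT)
    rw [h] at hT'
    exact (AddSubgroup.mem_bot).mp hT'
  set i : (W.baseChange K).toAffine.Point →+ (W.baseChange (ringClassField K ι 1)).toAffine.Point :=
    Affine.Point.map (W' := W) (algebraMap K (ringClassField K ι 1)).toRatAlgHom with hi
  have hiinj : Function.Injective i := Affine.Point.map_injective (W' := W) _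
  have h2K : ∀ T : (W.baseChange K).toAffine.Point, (2 : ℤ) • T = 0 → T = 0 := by
    intro T hT
    apply hiinj
    rw [map_zero]
    exact htors _ (by rw [← map_zsmul, hT, map_zero])
  -- `P₀` is a Heegner point (it maps to `P(1)`, as does the tree's Heegner point; `E(K) → E(K[1])` is injective)
  obtain ⟨P₁, hP₁H, hP₁⟩ := heegnerSystem_exists_isHeegnerPoint_map_eq_derivedPoint_one
    (heegnerPointOfConductor_one_galoisConj_holds (W.conductorNorm ℤ) W K) hK hH d₁
  have hP₀H : IsHeegnerPoint (W.conductorNorm ℤ) W K P₀ := hiinj (hP₁.trans hP₀.symm) ▸ hP₁H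
  -- `w(E) = +1`
  have hw1 : W.rootNumber = 1 := W.rootNumber_eq_one_of_even_analyticRank (by rw [hr0]; exact Even.zero)
  -- McCallum 5.1: `2^{M₀} ∣ y_K` in `E(K)`
  have hdivK : ∃ Q₀ : (W.baseChange K).toAffine.Point, ((2 ^ M₀ : ℕ) : ℤ) • Q₀ = P₀ := by
    obtain ⟨Q, hQ⟩ := hdiv
    have h := (McCallum1991.exists_pow_smul_eq_derivedPoint_one_iff hK d₁ (p := 2) htors hP₀ M₀).mp
      ⟨Q, by simpa only [Nat.cast_pow, Nat.cast_ofNat] using hQ⟩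
    obtain ⟨Q₀, hQ₀⟩ := h
    exact ⟨Q₀, by simpa only [Nat.cast_pow, Nat.cast_ofNat] using hQ₀⟩
  obtain ⟨s, hsfin, hsfix, hs⟩ :=
    geomReduction_heegnerPoint_eq_of_two_pow_smul W hK hH hP₀H hw1 h2K hℓ hΔ hM hdivK
  exact hred s hsfin hsfix hs

/-- **THE CRUXES' DEEP CLAUSE WITH `n = 1` FROM ONE REDUCTION.**  Under the hypotheses of `depth_eq_zero_of_geomReduction_ne`, with McCallum's
exponent `M₀` in its registered normal form (`2^{M₀} ∣ y_K`, `2^{M₀+1} ∤ y_K` in `E(K[1])`): `M₀ = 0`, so the conductor-`1` datum itself witnesses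
`∃ n d, Squarefree n ∧ (∀ q ∣ n, Pred q) ∧ P(n) ∉ 2E(K[n])` for ANY predicate `Pred` on the prime factors (the deep / transposition-deep
conditions of 23491 / 25504 hold vacuously at `n = 1`; LEAD `exists_deepWitness_of_depth_zero`).  So on the curves where `y_K` avoids
`red(E(K)_tors^{Gal})` at ONE good ramified prime the registered stubs C‴ / C⁺‴ are not needed.
[cite: GrossLMS1991, §4 (4.1) (P(1) = y_K), §5 Prop. 5.3] [cite: McCallumLMS1991, §5 Lemma 5.1] -/
theorem exists_deepWitness_of_geomReduction_ne (W : WeierstrassCurve ℚ) [W.IsElliptic] [W.IsGloballyMinimal]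
    [NeZero (W.conductorNorm ℤ)] (hK : IsImaginaryQuadratic K) (hH : SatisfiesHeegnerHypothesis (W.conductorNorm ℤ) K)
    (hr0 : W.analyticRank = 0) (hρ : W.HasSurjectiveModNGaloisRep 2) (hsq : ¬ IsSquare ((NumberField.discr K : ℚ) * W.Δ))
    {ℓ : ℕ} [Fact ℓ.Prime] (hℓ : (ℓ : ℤ) ∣ NumberField.discr K) (hΔ : ¬ (ℓ : ℤ) ∣ minimalDiscriminantInt W)
    (Dt : ModularParametrizationData W (W.conductorNorm ℤ)) (β : ℤ) (ι : K →+* ℂ) (d₁ : KolyvaginHeegnerData Dt β ι 1)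
    {P₀ : (W.baseChange K).toAffine.Point}
    (hP₀ : Affine.Point.map (W' := W) (algebraMap K (ringClassField K ι 1)).toRatAlgHom P₀ = d₁.derivedPoint)
    (hred : ∀ s : (W.baseChange K).toAffine.Point, IsOfFinAddOrder s → (∀ σ : K ≃ₐ[ℚ] K, σ • s = s) →
      geomReduction hΔ (Affine.Point.map (W' := W) (absEmbedding ℚ K) P₀ : W.geomPoints) ≠
        geomReduction hΔ (Affine.Point.map (W' := W) (absEmbedding ℚ K) s : W.geomPoints))
    {M₀ : ℕ} (hdiv : ∃ Q : (W.baseChange (ringClassField K ι 1)).toAffine.Point, ((2 ^ M₀ : ℕ) : ℤ) • Q = d₁.derivedPoint)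
    (hndiv : ¬ ∃ Q : (W.baseChange (ringClassField K ι 1)).toAffine.Point, ((2 ^ (M₀ + 1) : ℕ) : ℤ) • Q = d₁.derivedPoint)
    (Pred : ℕ → Prop) :
    ∃ (n : ℕ) (d : KolyvaginHeegnerData Dt β ι n), Squarefree n ∧ (∀ q ∈ n.primeFactors, Pred q) ∧
      ¬ ∃ Q : (W.baseChange (ringClassField K ι n)).toAffine.Point, (2 : ℤ) • Q = d.derivedPoint := by
  have hM0 : M₀ = 0 := depth_eq_zero_of_geomReduction_ne W hK hH hr0 hρ hsq hℓ hΔ Dt β ι d₁ hP₀ hred hdiv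
  subst hM0
  exact exists_deepWitness_of_depth_zero W Dt β ι d₁ Pred hndiv

end Summit.BirchSwinnertonDyer.BirchSwinnertonDyer.Theorems.GenusSupplyNarrow.DepthZero

end
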